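/-
Copyright (c) 2026. All rights reserved.
Released under Apache 2.0 license as described in the file LICENSE.
Authors: abc-iut cell — seat abc-iut-w5-d225 (wave 5; L6-lead §F v1.18p «NV-L6 WAVE», row NV-L6/TwoTorsionTranslates).
-/
import Literature.IUT.HodgeArakelov.LabelClassesOfCusps
import Literature.IUT.HodgeArakelov.PlusMinusTowerNonVacuity
import HarnessLib

/-!
# Non-vacuity of `TwoTorsionTranslates` ([IUTchII] Cor 2.4 (ii), data (a)(b)(c))

S. Mochizuki, *Inter-universal Teichmüller Theory II*, kurims manuscript (Dec. 2020), §2, Cor 2.4 (ii) p. 70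
("(Two-torsion Translates of Cusps)": an inclusion `I^δ_t ⊆ Π^δ_{v□}` determines (a) the decomposition group
`D^δ_t := N_{Π^δ_v}(I^δ_t)`, (b) a decomposition group `D^δ_{μ_-}`, (c) a decomposition group
`D^δ_{t,μ_-} ⊆ Π^δ_{v□̈}`). abc-iut-L6-t1 typed the datum as the structure
`Literature.IUT.HodgeArakelov.TwoTorsionTranslates W H I δ` (`LabelClassesOfCusps.lean`): field `incl` (the given
inclusion), (a) DEFINED (`TwoTorsionTranslates.Dt`), (b) `Dmu` and (c) `Dtmu` carried as bare subgroups with the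
single constraint `Dtmu_le : Dtmu ≤ Π^δ_{v□̈}` — their defining property ([SemiAnbd] Thm 6.8 (iii)) is not in the
tree (TODO-merge abc-iut-L3-t4), as disclosed by abc-iut-L6-d1's `cor24_ii_iii'_iff` (`LabelClassesOfCuspsR.lean`).

abc-iut-w5-d114's INHABITATION CENSUS v3 (§A) lists `TwoTorsionTranslates` with ZERO producers / `Nonempty`
statements.  This PROOF-ONLY file (no `def`/`instance`/`structure`) records the exact inhabitation content:

* `TwoTorsionTranslates.nonempty_iff` — over ANY `±`-tower `W`, subgroup `Π_{v□} = H`, subgroup `I ⊆ Π̂^cor_v` and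
  `δ ∈ Π̂^cor_v`: the structure is inhabited **iff** the inclusion `I^δ ⊆ Π^δ_{v□}` holds (⇒: the field `incl`;
  ⇐: the CANONICAL AMBIENT data `D^δ_{μ_-} = D^δ_{t,μ_-} := Π^δ_{v□̈}`, the same choice as in abc-iut-L6-d1's
  `cor24_ii_iii'_iff`).  So, as typed, the record carries no content beyond its `incl` field.
* `TwoTorsionTranslates.nonempty_degenerate` — in the binder shape of the repaired family `Cor24_ii_iii'`
  (`I ⊆ Δ_{v□}`): inhabited for every `δ`.  HONEST LABEL «degenerate»: the (b)(c) data of the witness are the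
  ambient group `Π^δ_{v□̈}`, NOT the printed decomposition groups of the `μ_-`-translate (those need
  [SemiAnbd] Thm 6.8 (iii)); (a) is the genuine normaliser by definition.
* `TwoTorsionTranslates.isEmpty_iff` — the complementary statement.
* (v2 append) `TwoTorsionTranslates.exists_nonempty_degenerate` — a CLOSED instance over abc-iut-w5-d063's
  degenerate `±`-tower (`PlusMinusTower.nonempty_degenerate`), honestly labelled degenerate.

Instance level: a CLOSED inhabitant `Nonempty (TwoTorsionTranslates W₀ H I δ)` for a concrete tower `W₀` needs a
producer of `PlusMinusTower` (census §A: zero today; row «PlusMinusTower (+StableCurveAgreement)» of the NV-L6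
wave) — not supplied here.  Nothing in this file takes a side on [IUTchIII] Cor. 3.12; typed ≠ proved.
-/

namespace Literature.IUT.HodgeArakelov

universe u

variable {S : BadPlaceSetting.{u}} {P : TopGroup.{u}} {T : TemperedCoverings S P}

/-- **Exact inhabitation content of `TwoTorsionTranslates`** ([IUTchII] Cor 2.4 (ii) p. 70): over any `±`-tower,
the datum is inhabited iff the given inclusion `I^δ ⊆ Π^δ_{v□}` holds; the witness uses the canonical ambient
choice `D^δ_{μ_-} = D^δ_{t,μ_-} := Π^δ_{v□̈}` (as in abc-iut-L6-d1's `cor24_ii_iii'_iff`).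
[claim: Mochizuki2012, status: disputed] [cite: Mochizuki2012, II Cor 2.4 (ii) p.70] -/
theorem TwoTorsionTranslates.nonempty_iff (W : PlusMinusTower T) (H : Subgroup P) (I : Subgroup W.Corhat)
    (δ : W.Corhat) :
    Nonempty (TwoTorsionTranslates W H I δ) ↔
      I.map (MulAut.conj δ).toMonoidHom ≤ (W.box H).map (MulAut.conj δ).toMonoidHom := by
  constructor
  · rintro ⟨X⟩
    exact X.incl
  · intro h
    exact ⟨{ incl := h
             Dmu := (W.boxDd H).map (MulAut.conj δ).toMonoidHom
             Dtmu := (W.boxDd H).map (MulAut.conj δ).toMonoidHom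
             Dtmu_le := le_rfl }⟩

/-- **`TwoTorsionTranslates` is inhabited in the binder shape of the printed family** (`I ⊆ Δ_{v□}`, as in the
repaired `Cor24_ii_iii'`; the inclusion `I^δ ⊆ Π^δ_{v□}` "as in (i)" is then automatic), for every `δ ∈ Π̂^cor_v`.
DEGENERATE witness: (b)(c) are the canonical ambient subgroups `Π^δ_{v□̈}`, not the printed decomposition groups of
the `μ_-`-translate ([SemiAnbd] Thm 6.8 (iii), not in the tree). [claim: Mochizuki2012, status: disputed]
[cite: Mochizuki2012, II Cor 2.4 (ii) p.70] -/
theorem TwoTorsionTranslates.nonempty_degenerate (W : PlusMinusTower T) (H : Subgroup P)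
    {I : Subgroup W.Corhat} (hI : I ≤ W.deltaBox H) (δ : W.Corhat) :
    Nonempty (TwoTorsionTranslates W H I δ) :=
  (TwoTorsionTranslates.nonempty_iff W H I δ).2 (Subgroup.map_mono (le_trans hI inf_le_left))

/-- … and it is EMPTY exactly when the given inclusion fails (the record is its `incl` field plus free data).
[claim: Mochizuki2012, status: disputed] [cite: Mochizuki2012, II Cor 2.4 (ii) p.70] -/
theorem TwoTorsionTranslates.isEmpty_iff (W : PlusMinusTower T) (H : Subgroup P) (I : Subgroup W.Corhat)
    (δ : W.Corhat) :
    IsEmpty (TwoTorsionTranslates W H I δ) ↔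
      ¬ I.map (MulAut.conj δ).toMonoidHom ≤ (W.box H).map (MulAut.conj δ).toMonoidHom := by
  rw [← not_nonempty_iff, TwoTorsionTranslates.nonempty_iff]

/-! ### v2 (append): a CLOSED degenerate instance, over abc-iut-w5-d063's degenerate `±`-tower -/

/-- **CLOSED DEGENERATE instance of `TwoTorsionTranslates`** (v2 append, after abc-iut-w5-d063's
`PlusMinusTower.nonempty_degenerate`, p420440): over the degenerate `±`-tower of `PlusMinusTowerNonVacuity`
(trivial tempered groups, artificial `C₃ × C₆` completion), with `Π_{v□} := ⊤`, `I := ⊥`, `δ := 1`, the datum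
is inhabited (canonical ambient (b)(c) data).  HONEST LABEL «degenerate» on both counts (tower and data).
[claim: Mochizuki2012, status: disputed] [cite: Mochizuki2012, II Cor 2.4 (ii) p.70] -/
theorem TwoTorsionTranslates.exists_nonempty_degenerate :
    ∃ (S : BadPlaceSetting.{0}) (P : TopGroup.{0}) (T : TemperedCoverings S P) (W : PlusMinusTower T)
      (H : Subgroup P) (I : Subgroup W.Corhat) (δ : W.Corhat), Nonempty (TwoTorsionTranslates W H I δ) := by
  obtain ⟨S, P, T, ⟨W⟩⟩ := PlusMinusTower.nonempty_degenerate
  exact ⟨S, P, T, W, ⊤, ⊥, 1, TwoTorsionTranslates.nonempty_degenerate W ⊤ bot_le 1⟩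

end Literature.IUT.HodgeArakelov
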